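import Mathlib
import HarnessLib
import Literature.MathematicalPhysics.QuantumLattice.HubbardScaleZeroSectorSymbolSpace
import Literature.MathematicalPhysics.QuantumLattice.HubbardScaleZeroSectorSymbolTime
import Literature.MathematicalPhysics.QuantumLattice.HubbardScaleZeroSectorSymbolGeometry
import Summits.HubbardSuperconductivity.HubbardSuperconductivity.Theorems.KLProgrammeKLRegimeEngineScaleZeroNormsBi
import Summits.HubbardSuperconductivity.HubbardSuperconductivity.Theorems.KLProgrammeKLRegimeEngineScaleZeroSymbolSupport
import Summits.HubbardSuperconductivity.HubbardSuperconductivity.Theorems.KLProgrammeKLRegimeEngineFramePosKernelBound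
import Summits.HubbardSuperconductivity.HubbardSuperconductivity.Theorems.KLProgrammeKLRegimeEngineScaleZeroDecay
import Summits.HubbardSuperconductivity.HubbardSuperconductivity.Theorems.KLProgrammeKLRegimeSplitOnWindow

/-!
# K3 engine child (stmt-HubbardSuperconductivity-19855), stub `stub_engine_scale0`, clause (E1-v4)₀: the three SYMBOL hypotheses
# discharged — the scale-`0` norm bound with explicit `s₀`, `s₁`, `N_s` on every admissible frame

Cell gate-hubbard-kl, seat hubbard-kl-k3c2-p1.  `KLProgrammeKLRegimeEngineScaleZeroNormsBi.klAnisoLegKernelNorm_zero_le_of_symbol_bounds_bi`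
bounds `klAnisoLegKernelNorm … klE0 0 (2p)` given three numbers `(N_s, s₀, s₁)` of the padded scale-`0` multiplier.  Here they are
supplied: `hsupp` by `card_support_scaleZeroPadded_le` (this seat), `h₀` by p3's numeric time bound
`norm_fwdDiff_two_time_bgmGridSymbol_prod_le` (`(2π/β)²·448/(9e₀²) ≤ (16π/(βe₀))²`, i.e. `s₀ := βe₀/(16πM)`), `h₁` by p3's
space bound `norm_fwdDiff_two_space_bgmGridSymbol_prod_le` with its geometry (`le_abs_nambuXiCT_of_boundary`,
`le_norm_centred_of_abs_nambuXiCT_lt` at `r₁ = 17/10`, `κ := (16/15)·Gfr0·|U|` from `abs_eval_le_of_frameOK`, `D = 7` from k3c4-p2's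
`uvLineBound_of_frameOK`), `s₁ := 2/(π(C_s⋆ + 1))` with the `L`-free constant `C_s⋆` (`3/(r₁ - 4π/L) ≤ 2` for `L ≥ 2^15`).
What stays as hypotheses: the covariance sizes `α` (`hrow`/`hcol`, k3c4-p2's `rowSum/colSum_scaleZero_of_frameOK`), the profile entry
`kK ≥ Σ_z ‖Ǩ_L(z)‖` (`sum_norm_framePosKernel_le_of_frameOK`) and the smallness `θ < 1` — the inputs of the final numeric step.

* `scaleZeroPadded_eq_bgmGridSymbol` — the padded `klAnisoFamily` symbol IS p3's `bgmGridSymbol` (by definition);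
* `(22484224 / 9 + 7180 / 3 * sectorCircLineConst)` (`C_s⋆`) and **`klAnisoLegKernelNorm_zero_le_explicit`**.

Everything is proved; one harmless abbreviation (`(22484224 / 9 + 7180 / 3 * sectorCircLineConst)`, a closed-form real); no named facts, no sorry.
-/

noncomputable section

namespace Summit.HubbardSuperconductivity.HubbardSuperconductivity.Theorems.EngineV8

set_option linter.dupNamespace false -- summit = problem name (single-conjunct summit), D-0017

open Real Finset Literature.MathematicalPhysics.QuantumLattice Literature.Probability.LatticeModels
open Summit.HubbardSuperconductivity.HubbardSuperconductivity.Theorems.KLRegimeSplit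
open Summit.HubbardSuperconductivity.HubbardSuperconductivity.Theorems.KLProgrammeLegKernels
open Summit.HubbardSuperconductivity.HubbardSuperconductivity.Theorems.ScaleZeroDecay

variable {L M : ℕ} [NeZero L]

omit [NeZero L] in
/-- **The padded scale-`0` symbol is p3's `bgmGridSymbol`** (`klAnisoFamily … e₀ 0 = bgmMultiplier e₀ β e_K 0` by definition). -/
theorem scaleZeroPadded_eq_bgmGridSymbol (β μ : ℝ) (K : TrigPolyC4v) (e₀ : ℝ) (ω : Fin (sectorCount 0)) :
    (fun q : TorusSite 1 (2 * (2 * M)) × TorusSite 2 L =>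
        if h : (q.1 0).val < 2 * M then klAnisoFamily L M β μ K e₀ 0 ω (⟨(q.1 0).val, h⟩, q.2) else 0) =
      fun q => bgmGridSymbol L M (2 * (2 * M)) e₀ β μ K ω q.1 q.2 := by
  funext q
  rfl
set_option maxHeartbeats 400000 in
/-- **(E1-v4)₀ with the symbol layer discharged**: for an admissible frame (`FrameOK R U N μ K`, `Gfr ≥ 0`, `μ ∈ klWindowC`,
`(16/15)Gfr0|U| ≤ 1/50`), `2^15 ≤ L`, `klBetaMin ≤ β ≤ L`, `2 ≤ M`, `klE0·β ≤ π(2M-3)`, and the remaining sizes `α` (Gram-form covariance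
row/column sums), `kK ≥ Σ_z ‖Ǩ_L(z)‖`, `θ < 1`: for every `p ≥ 2`, `klAnisoLegKernelNorm … klE0 0 (2p)` is bounded by the bi-graded
bound of `klAnisoLegKernelNorm_zero_le_of_symbol_bounds_bi` at `s₀ := βe₀/(16πM)`, `s₁ := 2/(π(C_s⋆+1))`,
`N_s := #({|ω̃| < e₀} ×ˢ {|e_K| < e₀})`. -/
theorem klAnisoLegKernelNorm_zero_le_explicit [NeZero M] {R : RenConsts} {U : ℝ} {N : ℕ} {μ : ℝ} {K : TrigPolyC4v}
    (hK : FrameOK R U N μ K) (hR : ∀ j, 0 ≤ R.Gfr j) (hμ : μ ∈ klWindowC) (hκU : 16 / 15 * (R.Gfr 0 * |U|) ≤ 1 / 50)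
    (hL : (2 : ℝ) ^ 15 ≤ L) {β : ℝ} (hβ : klBetaMin ≤ β) (hβL : β ≤ L) (hM2 : 2 ≤ M)
    (hMβ : klE0 * β ≤ Real.pi * (2 * M - 3)) {kK : ℝ}
    (hkK : ∑ z : TorusSite 2 L, ‖framePosKernel L K z‖ ≤ kK)
    {α : ℝ} (hα : 0 < α)
    (hrow : ∀ X, ∑ Y, ‖((hubbardGridSub L M β (2 * (2 * M))).transpose * hubbardCovAboveCT L M β μ 0 K klE0 *
      hubbardGridSub L M β (2 * (2 * M))) X Y‖ ≤ α)
    (hcol : ∀ Y, ∑ X, ‖((hubbardGridSub L M β (2 * (2 * M))).transpose * hubbardCovAboveCT L M β μ 0 K klE0 *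
      hubbardGridSub L M β (2 * (2 * M))) X Y‖ ≤ α)
    (hθ : Real.exp 1 * α * normV (GridLeg (GridPoint L (2 * (2 * M)))) (Real.sqrt (2 * (7 + 6047))) (Real.sqrt (2 * (7 + 6047)))
      ((fun m' : ℕ => if m' = 1 then |β| / (2 * (2 * M) : ℕ) * kK else if m' = 2 then |U| * |β| / (2 * (2 * M) : ℕ) else 0)) /
        Real.sqrt (2 * (7 + 6047)) ^ 2 < 1)
    {p : ℕ} (hp : 2 ≤ p) :
    klAnisoLegKernelNorm L M β U μ K klE0 0 (2 * p) ≤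
      (1 / (|β| * (L : ℝ) ^ 2) *
        (Real.sqrt (2048 * (1 / (β * klE0 / (16 * Real.pi * M)) + 1) *
            (4 * ((2 * Real.sqrt 2 / (2 / (Real.pi * ((22484224 / 9 + 7180 / 3 * sectorCircLineConst) + 1))) + 2) *
              (2 * Real.sqrt 2 / (2 / (Real.pi * ((22484224 / 9 + 7180 / 3 * sectorCircLineConst) + 1))) + 2)) +
              16 * (1 / (2 / (Real.pi * ((22484224 / 9 + 7180 / 3 * sectorCircLineConst) + 1))) + 1) ^ 2)) *
          Real.sqrt (16 * (2 * (2 * M) : ℕ) * (L : ℝ) ^ 2 *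
            ((((univ : Finset (TorusSite 1 (2 * (2 * M)))).filter fun q₁ => |gridFreq M (2 * (2 * M)) β q₁| < klE0) ×ˢ
              ((univ : Finset (TorusSite 2 L)).filter fun k => |nambuXiCT L μ K k| < klE0)).card : ℕ)))) *
      (2 * (1 / (|β| * (L : ℝ) ^ 2) *
        (Real.sqrt (2048 * (1 / (β * klE0 / (16 * Real.pi * M)) + 1) *
            (4 * ((2 * Real.sqrt 2 / (2 / (Real.pi * ((22484224 / 9 + 7180 / 3 * sectorCircLineConst) + 1))) + 2) *
              (2 * Real.sqrt 2 / (2 / (Real.pi * ((22484224 / 9 + 7180 / 3 * sectorCircLineConst) + 1))) + 2)) +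
              16 * (1 / (2 / (Real.pi * ((22484224 / 9 + 7180 / 3 * sectorCircLineConst) + 1))) + 1) ^ 2)) *
          Real.sqrt (16 * (2 * (2 * M) : ℕ) * (L : ℝ) ^ 2 *
            ((((univ : Finset (TorusSite 1 (2 * (2 * M)))).filter fun q₁ => |gridFreq M (2 * (2 * M)) β q₁| < klE0) ×ˢ
              ((univ : Finset (TorusSite 2 L)).filter fun k => |nambuXiCT L μ K k| < klE0)).card : ℕ))))) ^ (2 * p - 1) *
      imagTimeWeight β M ^ (2 * p - 1) *
        ((Real.sqrt (2 * (7 + 6047)))⁻¹ ^ (2 * p) *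
          (Real.exp 1 * ((Real.exp 2 * (Real.sqrt (2 * (7 + 6047)) + Real.sqrt (2 * (7 + 6047)))) ^ (2 * 2) * (|U| * |β| / (2 * (2 * M) : ℕ)))) *
          (Real.exp 1 * α * ((Real.exp 2 * (Real.sqrt (2 * (7 + 6047)) + Real.sqrt (2 * (7 + 6047)))) ^ (2 * 2) * (|U| * |β| / (2 * (2 * M) : ℕ))) /
              Real.sqrt (2 * (7 + 6047)) ^ 2) ^ (p - 2) /
            (1 - Real.exp 1 * α * normV (GridLeg (GridPoint L (2 * (2 * M)))) (Real.sqrt (2 * (7 + 6047))) (Real.sqrt (2 * (7 + 6047)))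
              ((fun m' : ℕ => if m' = 1 then |β| / (2 * (2 * M) : ℕ) * kK else if m' = 2 then |U| * |β| / (2 * (2 * M) : ℕ) else 0)) /
                Real.sqrt (2 * (7 + 6047)) ^ 2) ^ p) := by
  -- elementary sizes
  have he : (0 : ℝ) < klE0 := by norm_num [klE0]
  have hβpos : 0 < β := lt_of_lt_of_le (by norm_num [klBetaMin]) hβ
  have hLpos : (0 : ℝ) < L := lt_of_lt_of_le (by norm_num) hL
  have hM2' : (2 : ℝ) ≤ M := by exact_mod_cast hM2
  have hMpos : (0 : ℝ) < M := by linarith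
  have hE : klE0 = 1 / 32 := by norm_num [klE0]
  have hπ := Real.pi_pos
  have hπ4 : Real.pi < 3.1416 := Real.pi_lt_d4
  have hB := sectorCircLineConst_nonneg
  have hCs : 0 ≤ (22484224 / 9 + 7180 / 3 * sectorCircLineConst) := by positivity
  obtain ⟨hμ1, hμ2⟩ := hμ
  -- `κ = sup|K|`
  have hKκ : ∀ q : Fin 2 → ℝ, |K.eval q| ≤ 16 / 15 * (R.Gfr 0 * |U|) := abs_eval_le_of_frameOK hK hR
  -- the parameters
  set s₀ : ℝ := β * klE0 / (16 * Real.pi * M) with hs₀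
  set s₁ : ℝ := 2 / (Real.pi * ((22484224 / 9 + 7180 / 3 * sectorCircLineConst) + 1)) with hs₁
  have hs₀pos : 0 < s₀ := by rw [hs₀]; positivity
  have hs₁pos : 0 < s₁ := by rw [hs₁]; positivity
  -- geometry of the lattice: `4π/L ≤ 2^{-11}`
  have h4πL : 4 * Real.pi / L ≤ 1 / 2 ^ 11 := by
    rw [div_le_iff₀ hLpos]
    have : (4 : ℝ) * Real.pi ≤ 2 ^ 4 := by linarith
    calc 4 * Real.pi ≤ 2 ^ 4 := this
      _ = 1 / 2 ^ 11 * 2 ^ 15 := by norm_num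
      _ ≤ 1 / 2 ^ 11 * L := by gcongr
  have hL8 : 8 < L := by
    have : (8 : ℝ) < L := lt_of_lt_of_le (by norm_num) hL
    exact_mod_cast this
  have hL8' : 8 ≤ L := hL8.le
  -- (hsupp)
  have hMβ' : klE0 * β ≤ Real.pi * (2 * M + 1) := hMβ.trans (mul_le_mul_of_nonneg_left (by linarith) hπ.le)
  have hsupp := fun ω : Fin (sectorCount 0) => card_support_scaleZeroPadded_le (L := L) hβpos hMβ' μ K ω
  -- (h₀) numeric time bound
  have hMN : 2 * M ≤ 2 * (2 * M) := by omega
  have h₀ : ∀ (ω : Fin (sectorCount 0)) (q : TorusSite 1 (2 * (2 * M)) × TorusSite 2 L),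
      ‖(fwdDiff ((fun _ : Fin 1 => (1 : ZMod (2 * (2 * M)))), (0 : TorusSite 2 L)))^[2]
        (fun q : TorusSite 1 (2 * (2 * M)) × TorusSite 2 L =>
          if h : (q.1 0).val < 2 * M then klAnisoFamily L M β μ K klE0 0 ω (⟨(q.1 0).val, h⟩, q.2) else 0) q‖ ≤
        (4 / (s₀ * (2 * (2 * M) : ℕ))) ^ 2 := by
    intro ω q
    rw [scaleZeroPadded_eq_bgmGridSymbol]
    refine (norm_fwdDiff_two_time_bgmGridSymbol_prod_le he hβpos hM2 hMN hMβ μ K ω q).trans ?_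
    have hval : (4 / (s₀ * (2 * (2 * M) : ℕ))) ^ 2 = 256 * Real.pi ^ 2 / (β ^ 2 * klE0 ^ 2) := by
      rw [hs₀]
      push_cast
      field_simp
      ring
    rw [hval, div_pow, le_div_iff₀ (by positivity)]
    field_simp
    nlinarith [sq_nonneg Real.pi, sq_nonneg β, he]
  -- (h₁) numeric space bound with the frame geometry
  have hzone : ∀ (l : Fin 2) (k : TorusSite 2 L), |2 * (((k l).val : ℤ)) - L| ≤ 4 → klE0 ≤ |nambuXiCT L μ K k| := by
    intro l k hk
    refine le_abs_nambuXiCT_of_boundary hL8' hKκ ?_ l k hk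
    -- `klE0 ≤ 2cos(4π/L) - 2 - μ - κ`
    have hcos : 1 - (4 * Real.pi / L) ^ 2 / 2 ≤ Real.cos (4 * Real.pi / L) := Real.one_sub_sq_div_two_le_cos
    have hsmall : (4 * Real.pi / L) ^ 2 ≤ (1 / 2 ^ 11) ^ 2 := pow_le_pow_left₀ (by positivity) h4πL 2
    rw [hE]
    norm_num at hsmall ⊢
    nlinarith [hcos, hsmall, hμ2, hκU]
  have hr : ∀ k : TorusSite 2 L, |nambuXiCT L μ K k| < klE0 → (17 / 10 : ℝ) ≤ ‖momToComplex (torusCentredMomentum L k)‖ := by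
    intro k hk
    refine le_norm_centred_of_abs_nambuXiCT_lt hKκ ?_ k hk
    rw [hE]
    norm_num
    linarith [hμ1, hκU]
  have hr₁ : 4 * Real.pi / L < 17 / 10 := lt_of_le_of_lt h4πL (by norm_num)
  have hx : 3 / (17 / 10 - 4 * Real.pi / L) ≤ 2 := by
    rw [div_le_iff₀ (by linarith)]
    have : 4 * Real.pi / L ≤ 1 / 2 ^ 11 := h4πL
    linarith
  have hx0 : 0 ≤ 3 / (17 / 10 - 4 * Real.pi / L) := by
    have : 0 < 17 / 10 - 4 * Real.pi / L := by linarith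
    positivity
  have hD := uvLineBound_of_frameOK hK
  have h₁ : ∀ (ω : Fin (sectorCount 0)) (q : TorusSite 1 (2 * (2 * M)) × TorusSite 2 L) (i : Fin 2),
      ‖(fwdDiff ((0 : TorusSite 1 (2 * (2 * M))), (Pi.single i (1 : ZMod L) : TorusSite 2 L)))^[2]
        (fun q : TorusSite 1 (2 * (2 * M)) × TorusSite 2 L =>
          if h : (q.1 0).val < 2 * M then klAnisoFamily L M β μ K klE0 0 ω (⟨(q.1 0).val, h⟩, q.2) else 0) q‖ ≤ (4 / (s₁ * L)) ^ 2 := by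
    intro ω q i
    rw [scaleZeroPadded_eq_bgmGridSymbol]
    refine (norm_fwdDiff_two_space_bgmGridSymbol_prod_le (M := M) (N := 2 * (2 * M)) (β := β) he hL8 hD i (hzone i) hr hr₁ ω q).trans ?_
    -- the `L`-dependent constant is at most `C_s⋆`, and `(2π/L)²·C_s⋆ ≤ (4/(s₁L))²`
    set x : ℝ := 3 / (17 / 10 - 4 * Real.pi / L) with hxdef
    have hCsL : 448 / (9 * klE0 ^ 2) * 7 ^ 2 + 8 / (3 * klE0) * 7 + 2 * (8 / (3 * klE0) * 7) * (sectorCircLineConst * x) +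
        sectorCircLineConst * x ^ 2 ≤ (22484224 / 9 + 7180 / 3 * sectorCircLineConst) := by
      have h1 : sectorCircLineConst * x ≤ sectorCircLineConst * 2 := mul_le_mul_of_nonneg_left hx hB
      have h2 : sectorCircLineConst * x ^ 2 ≤ sectorCircLineConst * 2 ^ 2 :=
        mul_le_mul_of_nonneg_left (pow_le_pow_left₀ hx0 hx 2) hB
      rw [hE]
      norm_num
      nlinarith [h1, h2, hB]
    have hval : (4 / (s₁ * L)) ^ 2 = (2 * Real.pi / L) ^ 2 * ((22484224 / 9 + 7180 / 3 * sectorCircLineConst) + 1) ^ 2 := by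
      rw [hs₁]
      field_simp
      ring
    rw [hval]
    refine mul_le_mul_of_nonneg_left (hCsL.trans ?_) (by positivity)
    nlinarith
  -- assemble
  exact klAnisoLegKernelNorm_zero_le_of_symbol_bounds_bi hK hβ hβL hkK hα hrow hcol hθ hs₀pos hs₁pos
    (fun ω => hsupp ω) h₀ h₁ hp

end Summit.HubbardSuperconductivity.HubbardSuperconductivity.Theorems.EngineV8

end
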